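import Mathlib
import Literature.Probability.RandomPlanarGeometry.ConformalMap

/-!
# Rotation covariance of the continuum data of `HexObservableLimitR` (line `bridge-gate-renewal`
of the crux `SAWDefectDecoherence.ObservableToSLER`, stmt-CriticalPhenomena-14005; helper 2 of
stub 3a `stub_orientationCoOriented`, reshape r4)

Stub 3a transports the route hypothesis `HexObservableLimitR` (orientation class `(0, 0)`) to the
six co-oriented classes `(j, j)` by the global rotation `z ↦ conj(u) z`, `u = ζ^j`.  This file is
the CONTINUUM half of that transport, for an arbitrary unit `u` (`‖u‖ = 1`) and an arbitrary set
`S ⊆ ℂ` (the carrier of the Dobrushin domain), the rotated set being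
`(Homeomorph.mulLeft₀ (conj u) _) '' S` (the carrier of `MarkedDomain.map`):

* `mem_image_mulLeft_conj_iff : z ∈ conj(u) S ↔ u z ∈ S`, `mul_mem_ball_iff`;
* `flat_clause_rot` — the flat clause `S ∩ B(p, ρ) = {0 < im(conj u (z − p))} ∩ B(p, ρ)` of class
  `j` becomes the HORIZONTAL clause `{im(conj u p) < im z}` of `HexObservableLimitR` at `conj(u) p`;
* `tendsto_mul_nhdsWithin` and its corollaries — the normalisations `‖Φ‖ → ∞` at `p₀`, `Φ → 0` at
  `p₁`, `L → L_b` at `p₁` transport to `Φ ∘ (u ·)`, `L ∘ (u ·) + c` at the rotated marked points;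
* `exp_comp_mul_add_eq_deriv` — the chain rule `exp (L (u z) + c) = (Φ ∘ (u ·))' z` when
  `exp L = Φ'` and `exp c = u`; `continuousOn_comp_mul_add`;
* the test function: `continuous_comp_mul`, `hasCompactSupport_comp_mul`, `tsupport_comp_mul_subset`;
* `integral_comp_mul_of_norm_one` — rotation invariance of the Lebesgue integral on `ℂ`
  (`rotation : Circle →* ℂ ≃ₗᵢ[ℝ] ℂ` is measure preserving), whence `limit_integral_rot`: the limit
  `∫ ψ exp(σ (L − L_b))` of `HexObservableLimitR` is the same for the rotated data
  (`L₀ − L_{b,0} = (L − L_b) ∘ (u ·)`);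
* `tendsto_mul_midpoint` — convergence of the rescaled marked mid-edges transports.

Registered bookkeeping theorem: `stub_coOrientedContinuum` (= `limit_integral_rot`, binder form).
No definition is introduced.  Sources: folklore (change of variables under a rotation); pattern
`Theorems/HexObservableLimitR/Negative/MirrorInstance.lean` (the mirrored uniformiser).
-/

noncomputable section

open scoped BigOperators Topology ComplexConjugate
open Filter Set MeasureTheory Metric
open Literature.Probability.RandomPlanarGeometry

namespace Summit.CriticalPhenomena.SAWScalingLimit.Theorems.ObservableToSLER.BridgeGate.CoOriented

variable {u : ℂ}

/-- A unit complex number is nonzero. -/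
theorem ne_zero_of_norm_one (hu : ‖u‖ = 1) : u ≠ 0 :=
  norm_ne_zero_iff.1 (by rw [hu]; exact one_ne_zero)

/-- `conj u ≠ 0` for a unit `u`. -/
theorem conj_ne_zero_of_norm_one (hu : ‖u‖ = 1) : conj u ≠ 0 :=
  (map_ne_zero (starRingEnd ℂ)).2 (ne_zero_of_norm_one hu)

/-- `conj u · u = 1` for a unit `u`. -/
theorem conj_mul_of_norm_one (hu : ‖u‖ = 1) : conj u * u = 1 := by
  rw [← Complex.inv_eq_conj hu, inv_mul_cancel₀ (ne_zero_of_norm_one hu)]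

/-- `u · conj u = 1` for a unit `u`. -/
theorem mul_conj_of_norm_one (hu : ‖u‖ = 1) : u * conj u = 1 := by
  rw [mul_comm, conj_mul_of_norm_one hu]

/-- `u (conj u z) = z`. -/
theorem mul_conj_mul (hu : ‖u‖ = 1) (z : ℂ) : u * (conj u * z) = z := by
  rw [← mul_assoc, mul_conj_of_norm_one hu, one_mul]

/-- `conj u (u z) = z`. -/
theorem conj_mul_mul (hu : ‖u‖ = 1) (z : ℂ) : conj u * (u * z) = z := by
  rw [← mul_assoc, conj_mul_of_norm_one hu, one_mul]

/-- **Membership in the rotated set:** `z ∈ conj(u) · S ↔ u z ∈ S`. -/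
theorem mem_image_mulLeft_conj_iff (hu : ‖u‖ = 1) (S : Set ℂ) (z : ℂ) :
    z ∈ (Homeomorph.mulLeft₀ (conj u) (conj_ne_zero_of_norm_one hu)) '' S ↔ u * z ∈ S := by
  constructor
  · rintro ⟨w, hw, rfl⟩
    show u * (conj u * w) ∈ S
    rwa [mul_conj_mul hu]
  · intro h
    exact ⟨u * z, h, conj_mul_mul hu z⟩

/-- Rotations are isometries: `dist (u z) p = dist z (conj u · p)`. -/
theorem dist_mul_left_eq (hu : ‖u‖ = 1) (z p : ℂ) : dist (u * z) p = dist z (conj u * p) := by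
  rw [dist_eq_norm, dist_eq_norm, show u * z - p = u * (z - conj u * p) by
    rw [mul_sub, mul_conj_mul hu], norm_mul, hu, one_mul]

/-- `u z ∈ B(p, ρ) ↔ z ∈ B(conj u · p, ρ)`. -/
theorem mul_mem_ball_iff (hu : ‖u‖ = 1) (z p : ℂ) (ρ : ℝ) :
    u * z ∈ ball p ρ ↔ z ∈ ball (conj u * p) ρ := by
  rw [mem_ball, mem_ball, dist_mul_left_eq hu]

/-- **The flat clause rotates to the horizontal one:** if `S ∩ B(p, ρ)` is the half-ball
`{0 < im(conj u · (z − p))} ∩ B(p, ρ)`, then `conj(u) · S ∩ B(conj u · p, ρ)` is the horizontal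
half-ball `{im(conj u · p) < im z} ∩ B(conj u · p, ρ)`. -/
theorem flat_clause_rot (hu : ‖u‖ = 1) {S : Set ℂ} {p : ℂ} {ρ : ℝ}
    (h : S ∩ ball p ρ = {z : ℂ | 0 < (conj u * (z - p)).im} ∩ ball p ρ) :
    (Homeomorph.mulLeft₀ (conj u) (conj_ne_zero_of_norm_one hu)) '' S ∩ ball (conj u * p) ρ =
      {z : ℂ | (conj u * p).im < z.im} ∩ ball (conj u * p) ρ := by
  ext z
  simp only [mem_inter_iff, mem_setOf_eq, mem_image_mulLeft_conj_iff hu]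
  constructor
  · rintro ⟨hz, hb⟩
    have h1 : u * z ∈ S ∩ ball p ρ := ⟨hz, (mul_mem_ball_iff hu z p ρ).2 hb⟩
    rw [h] at h1
    have h2 := h1.1
    rw [mem_setOf_eq, mul_sub, conj_mul_mul hu, Complex.sub_im, sub_pos] at h2
    exact ⟨h2, hb⟩
  · rintro ⟨hz, hb⟩
    have h1 : u * z ∈ {z : ℂ | 0 < (conj u * (z - p)).im} ∩ ball p ρ := by
      refine ⟨?_, (mul_mem_ball_iff hu z p ρ).2 hb⟩
      rw [mem_setOf_eq, mul_sub, conj_mul_mul hu, Complex.sub_im, sub_pos]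
      exact hz
    rw [← h] at h1
    exact ⟨h1.1, hb⟩

/-- **The rotation maps neighbourhoods within the rotated set to neighbourhoods within the set.** -/
theorem tendsto_mul_nhdsWithin (hu : ‖u‖ = 1) (S : Set ℂ) (p : ℂ) :
    Tendsto (fun z => u * z)
      (𝓝[(Homeomorph.mulLeft₀ (conj u) (conj_ne_zero_of_norm_one hu)) '' S] (conj u * p))
      (𝓝[S] p) := by
  have h : Tendsto (fun z => u * z)
      (𝓝[(Homeomorph.mulLeft₀ (conj u) (conj_ne_zero_of_norm_one hu)) '' S] (conj u * p))
      (𝓝[S] (u * (conj u * p))) :=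
    ((continuous_const_mul u).continuousWithinAt).tendsto_nhdsWithin fun z hz =>
      (mem_image_mulLeft_conj_iff hu S z).1 hz
  rwa [mul_conj_mul hu] at h

/-- Transport of the blow-up normalisation `‖Φ‖ → ∞` at a marked point. -/
theorem tendsto_norm_comp_mul_atTop (hu : ‖u‖ = 1) {S : Set ℂ} {p : ℂ} {Φ : ℂ → ℂ}
    (h : Tendsto (fun x => ‖Φ x‖) (𝓝[S] p) atTop) :
    Tendsto (fun x => ‖Φ (u * x)‖)
      (𝓝[(Homeomorph.mulLeft₀ (conj u) (conj_ne_zero_of_norm_one hu)) '' S] (conj u * p)) atTop :=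
  h.comp (tendsto_mul_nhdsWithin hu S p)

/-- Transport of a boundary value / limit within the set at a marked point. -/
theorem tendsto_comp_mul_nhdsWithin (hu : ‖u‖ = 1) {S : Set ℂ} {p : ℂ} {f : ℂ → ℂ} {l : Filter ℂ}
    (h : Tendsto f (𝓝[S] p) l) :
    Tendsto (fun x => f (u * x))
      (𝓝[(Homeomorph.mulLeft₀ (conj u) (conj_ne_zero_of_norm_one hu)) '' S] (conj u * p)) l :=
  h.comp (tendsto_mul_nhdsWithin hu S p)

/-- Transport of continuity of the logarithm `L`. -/
theorem continuousOn_comp_mul_add (hu : ‖u‖ = 1) {S : Set ℂ} {L : ℂ → ℂ} (hL : ContinuousOn L S)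
    (c : ℂ) :
    ContinuousOn (fun z => L (u * z) + c)
      ((Homeomorph.mulLeft₀ (conj u) (conj_ne_zero_of_norm_one hu)) '' S) :=
  (hL.comp (continuous_const_mul u).continuousOn fun z hz =>
    (mem_image_mulLeft_conj_iff hu S z).1 hz).add continuousOn_const

/-- **Chain rule for the rotated uniformiser:** on the (open) rotated set,
`exp (L (u z) + c) = (Φ ∘ (u ·))' z` as soon as `exp L = Φ'` on `S` and `exp c = u`. -/
theorem exp_comp_mul_add_eq_deriv (hu : ‖u‖ = 1) {S : Set ℂ} (hS : IsOpen S) {Φ L : ℂ → ℂ}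
    (hΦ : DifferentiableOn ℂ Φ S) (hexp : ∀ z ∈ S, Complex.exp (L z) = deriv Φ z) {c : ℂ}
    (hc : Complex.exp c = u) :
    ∀ z ∈ (Homeomorph.mulLeft₀ (conj u) (conj_ne_zero_of_norm_one hu)) '' S,
      Complex.exp (L (u * z) + c) = deriv (fun w => Φ (u * w)) z := by
  intro z hz
  have huz : u * z ∈ S := (mem_image_mulLeft_conj_iff hu S z).1 hz
  have hd : HasDerivAt Φ (deriv Φ (u * z)) (u * z) :=
    (hΦ.differentiableAt (hS.mem_nhds huz)).hasDerivAt
  have hm : HasDerivAt (fun w : ℂ => u * w) u z := by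
    simpa using (hasDerivAt_id z).const_mul u
  have hcomp : HasDerivAt (fun w => Φ (u * w)) (deriv Φ (u * z) * u) z := hd.comp z hm
  rw [hcomp.deriv, Complex.exp_add, hexp _ huz, hc]

/-- Transport of the test function: continuity. -/
theorem continuous_comp_mul {ψ : ℂ → ℂ} (hψ : Continuous ψ) (u : ℂ) :
    Continuous (fun z => ψ (u * z)) :=
  hψ.comp (continuous_const_mul u)

/-- Transport of the test function: compact support. -/
theorem hasCompactSupport_comp_mul (hu : ‖u‖ = 1) {ψ : ℂ → ℂ} (hψ : HasCompactSupport ψ) :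
    HasCompactSupport (fun z => ψ (u * z)) :=
  hψ.comp_homeomorph (Homeomorph.mulLeft₀ u (ne_zero_of_norm_one hu))

/-- Transport of the test function: support inside the rotated domain. -/
theorem tsupport_comp_mul_subset (hu : ‖u‖ = 1) {ψ : ℂ → ℂ} {S : Set ℂ} (hψ : tsupport ψ ⊆ S) :
    tsupport (fun z => ψ (u * z)) ⊆
      (Homeomorph.mulLeft₀ (conj u) (conj_ne_zero_of_norm_one hu)) '' S := by
  intro z hz
  rw [mem_image_mulLeft_conj_iff hu]
  apply hψ
  have h : (fun z => ψ (u * z)) = ψ ∘ (Homeomorph.mulLeft₀ u (ne_zero_of_norm_one hu)) := rfl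
  rw [h, tsupport, Function.support_comp_eq_preimage, ← Homeomorph.preimage_closure] at hz
  exact hz

/-- **Rotation invariance of the Lebesgue integral on `ℂ`:** `∫ G (u z) dz = ∫ G (z) dz` for a
unit `u`. -/
theorem integral_comp_mul_of_norm_one (hu : ‖u‖ = 1) (G : ℂ → ℂ) :
    ∫ z, G (u * z) = ∫ z, G z := by
  let a : Circle := ⟨u, mem_sphere_zero_iff_norm.2 hu⟩
  have h := (rotation a).measurePreserving.integral_comp'
    (f := (rotation a).toHomeomorph.toMeasurableEquiv) G
  simpa [rotation_apply] using h

/-- The limit integral of `R` is rotation invariant: with `L₀ z = L (u z) + c`, `Lb₀ = Lb + c`,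
`ψ₀ z = ψ (u z)`: `∫ ψ₀ · exp(σ (L₀ − Lb₀)) = ∫ ψ · exp(σ (L − Lb))`. -/
theorem limit_integral_rot (hu : ‖u‖ = 1) (ψ L : ℂ → ℂ) (Lb c σ : ℂ) :
    ∫ z, ψ (u * z) * Complex.exp (σ * (L (u * z) + c - (Lb + c))) =
      ∫ z, ψ z * Complex.exp (σ * (L z - Lb)) := by
  have h := integral_comp_mul_of_norm_one hu fun z => ψ z * Complex.exp (σ * (L z - Lb))
  rw [← h]
  congr 1
  funext z
  rw [add_sub_add_right_eq_sub]

/-- Transport of the convergence of rescaled mid-edges to a marked point. -/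
theorem tendsto_mul_midpoint (v : ℂ) {m : ℝ → ℂ} {p : ℂ} {l : Filter ℝ}
    (h : Tendsto (fun δ : ℝ => (δ : ℂ) * m δ) l (𝓝 p)) :
    Tendsto (fun δ : ℝ => (δ : ℂ) * (v * m δ + 0)) l (𝓝 (v * p)) := by
  have h2 := h.const_mul v
  refine h2.congr fun δ => ?_
  ring


/-! ### Registered bookkeeping theorem -/

/-- **REGISTERED SUB-GOAL `stub_coOrientedContinuum` (helper 2 of stub 3a
`stub_orientationCoOriented`, line `bridge-gate-renewal`, reshape r4):** the limit integral of
`HexObservableLimitR` is invariant under rotating the data by a unit `u`: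
with `L₀ = L ∘ (u ·) + c`, `L_{b,0} = L_b + c`, `ψ₀ = ψ ∘ (u ·)`,
`∫ ψ₀ exp(σ (L₀ − L_{b,0})) = ∫ ψ exp(σ (L − L_b))`. -/
theorem stub_coOrientedContinuum :
    ∀ (u : ℂ), ‖u‖ = 1 → ∀ (ψ L : ℂ → ℂ) (Lb c σ : ℂ),
      (∫ z, ψ (u * z) * Complex.exp (σ * (L (u * z) + c - (Lb + c)))) =
        ∫ z, ψ z * Complex.exp (σ * (L z - Lb)) :=
  fun _ hu ψ L Lb c σ => limit_integral_rot hu ψ L Lb c σ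

end Summit.CriticalPhenomena.SAWScalingLimit.Theorems.ObservableToSLER.BridgeGate.CoOriented

end
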